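import Literature.AlgebraicGeometry.Motives.AbelianVarietyPermutationPowerIsotypicalMultiplicity
import HarnessLib

/-!
# The regular power `A^G = A ⊗ ℤ[G]`: every isotypical component is non-zero, `B_W(A^G) ∼ A^{[ℚ(χ):ℚ] · χ(1)²}`

Let `A^G` be the REGULAR permutation power of an abelian variety `A` (bicone `b` over `(A)_{h ∈ G}` with `Σ_h π_h ≫ ι_h = 𝟙`,
`G` finite acting by `ι_h ≫ ρ(g) = ι_{g h}`), with isotypical components `B_W = Im u_W`, `W ∈ Irr_ℚ(G)`, in the vocabulary of
`Motives/AbelianVarietyGroupActionIsotypicalDecomposition` (`|G| e_W = Σ_g c_W(g) g`, `u_W = Σ_g c_W(g) ρ(g)`; hypotheses `hc`, `hu`;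
the component of the class `W ∋ χ` is addressed by `he : e = e_ℚ(χ)`).  The isotypical multiplicities of the regular module are
`dim (e_W ℂ[G]) = |𝒮(χ)| χ(1)² = [ℚ(χ):ℚ] χ(1)²` (`RepresentationTheory/FiniteGroups/PermutationModuleIsotypicalMultiplicity` §6,
Serre §2.4 Cor. 1), so by `Motives/AbelianVarietyPermutationPowerIsotypicalMultiplicity`:

* (any field) **`dim B_W(A^G) = [ℚ(χ):ℚ] · χ(1)² · dim A`**, `rk_ℤ Hom(B_W(A^G), B) = [ℚ(χ):ℚ] · χ(1)² · rk_ℤ Hom(A, B)`, and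
  **`B_W(A^G) ≠ 0` for EVERY `W`** as soon as `A ≠ 0` — in the regular power no isotypical component is missing
  (contrast `Motives/AbelianVarietyPermutationPowerTwoTransitive`, where all but two vanish); the trivial class: `dim B_1(A^G) = dim A`;
* (perfect field) **`B_W(A^G) ∼ A^{[ℚ(χ):ℚ] · χ(1)²}`** and `B_1(A^G) ∼ A` (the diagonal).

Lange–Rodríguez's group algebra decomposition `B_W ∼ C_W^{n_W}`, `n_W = χ(1)/s_W`, is finer and is not touched here.
Everything is a theorem (no definitions).

## References

* [SerreLinearRepresentations1977] J.-P. Serre, *Linear Representations of Finite Groups*, GTM 42 (1977), §2.4 Cor. 1 and Cor. 2,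
  §2.6 Thm. 8, §12.1.
* [LangeRodriguez2022] H. Lange, R. E. Rodríguez, *Decomposition of Jacobians by Prym Varieties*, LNM 2310 (2022), §2.8 (2.20),
  §2.9.1 Thm. 2.9.1, Prop. 2.9.3 (PDF pp. 39, 43, 46).
* [LangeRecillas2004] H. Lange, S. Recillas, *Abelian varieties with group action*, J. reine angew. Math. 575 (2004), §1 Prop. 1.1.
-/

noncomputable section

open CategoryTheory CategoryTheory.Limits MulAction
open Literature.NumberTheory.DiophantineGeometry
open Literature.RepresentationTheory.FiniteGroups

universe u

namespace Literature.AlgebraicGeometry.Motives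

namespace AbelianVariety

variable {K : Type u} [Field K] {A : AbelianVariety K} {G : Type} [Group G] [Fintype G] (b : Bicone (fun _ : G ↦ A))
  (ρ : G →* End b.pt) {c : ratCharIdempotents G → G → ℤ}
  (hc : ∀ e : ratCharIdempotents G,
    (Fintype.card G : ℚ) • (e : MonoidAlgebra ℚ G) = ∑ g, (c e g : ℚ) • MonoidAlgebra.of ℚ G g)
  {u : ratCharIdempotents G → (b.pt ⟶ b.pt)} (hu : ∀ e, End.of (u e) = ∑ g, c e g • ρ g)

omit [Fintype G] in
/-- The principal character is irreducible (`⟨1, 1⟩ = 1`). [folklore] -/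
private theorem isIrrChar_one [Finite G] : IsIrrChar G (1 : G → ℂ) := by
  classical
  haveI : Fintype G := Fintype.ofFinite G
  refine isCharacter_one.isIrrChar_of_classInner_eq_one ?_
  rw [classInner_apply]
  simp only [Pi.one_apply, mul_one, Finset.sum_const, Finset.card_univ, nsmul_eq_mul]
  rw [inv_mul_cancel₀ (Nat.cast_ne_zero.mpr Fintype.card_ne_zero)]

include hc hu

/-! ## §1 Any field -/

/-- **`dim B_W(A^G) = [ℚ(χ):ℚ] · χ(1)² · dim A`** for the regular power and an irreducible `χ` of degree `d` in the rational class
`W` (any field). [cite: SerreLinearRepresentations1977, §2.4 Cor. 1 and §2.6 Thm. 8 (ii)] [cite: LangeRodriguez2022, §2.9.1 Prop. 2.9.3 (PDF p. 46)] -/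
theorem dim_isotypical_regular_permAction_eq (hb : ∑ h, b.π h ≫ b.ι h = 𝟙 b.pt)
    (hρ : ∀ (g h : G), b.ι h ≫ End.asHom (ρ g) = b.ι (g • h)) (e : ratCharIdempotents G) {χ : G → ℂ}
    (hχ : IsIrrChar G χ) (he : (e : MonoidAlgebra ℚ G) = ratCharIdempotent χ) {d : ℕ} (hd : χ 1 = d) :
    (image (u e)).dim = Module.finrank ℚ (charField χ) * d ^ 2 * A.dim := by
  rw [dim_isotypical_permAction_eq_finrank_mul b ρ hc hu hb hρ e, he,
    finrank_range_regular_ratCharIdempotent_eq_finrank_charField_mul hχ hd]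

/-- **`rk_ℤ Hom(B_W(A^G), B) = [ℚ(χ):ℚ] · χ(1)² · rk_ℤ Hom(A, B)`** for every `B` (regular power, any field).
[cite: SerreLinearRepresentations1977, §2.4 Cor. 1 and §2.6 Thm. 8 (ii)] [cite: LangeRodriguez2022, §2.9.1 Thm. 2.9.1 (PDF p. 43)] -/
theorem finrank_hom_isotypical_regular_permAction_eq (B : AbelianVariety K) (hb : ∑ h, b.π h ≫ b.ι h = 𝟙 b.pt)
    (hρ : ∀ (g h : G), b.ι h ≫ End.asHom (ρ g) = b.ι (g • h)) (e : ratCharIdempotents G) {χ : G → ℂ}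
    (hχ : IsIrrChar G χ) (he : (e : MonoidAlgebra ℚ G) = ratCharIdempotent χ) {d : ℕ} (hd : χ 1 = d) :
    Module.finrank ℤ (image (u e) ⟶ B) = Module.finrank ℚ (charField χ) * d ^ 2 * Module.finrank ℤ (A ⟶ B) := by
  rw [finrank_hom_isotypical_permAction_eq_finrank_mul b ρ hc hu B hb hρ e, he,
    finrank_range_regular_ratCharIdempotent_eq_finrank_charField_mul hχ hd]

/-- **In the regular power NO isotypical component vanishes: `dim B_W(A^G) > 0` for every `W ∈ Irr_ℚ(G)`** as soon as
`dim A > 0` (every irreducible rational representation occurs in `ℚ[G]`; any field).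
[cite: SerreLinearRepresentations1977, §2.4 Cor. 1] [cite: LangeRodriguez2022, §2.9.1 Thm. 2.9.1 and Prop. 2.9.3 (ii) (PDF pp. 43, 46)] -/
theorem dim_isotypical_regular_permAction_pos (hA : 0 < A.dim) (hb : ∑ h, b.π h ≫ b.ι h = 𝟙 b.pt)
    (hρ : ∀ (g h : G), b.ι h ≫ End.asHom (ρ g) = b.ι (g • h)) (e : ratCharIdempotents G) : 0 < (image (u e)).dim := by
  obtain ⟨χ, hχ, hχe⟩ := mem_ratCharIdempotents_iff.1 e.2
  rw [dim_isotypical_permAction_eq_finrank_mul b ρ hc hu hb hρ e, ← hχe]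
  exact Nat.mul_pos (finrank_range_regular_ratCharIdempotent_pos hχ) hA

/-- **`dim B_1(A^G) = dim A`**: the trivial component (the diagonal, Kani–Rosen's `B_G`) of the regular power (any field;
`dim (e_1 ℂ[G]) = |𝒮(1)| · 1² = 1`). [cite: SerreLinearRepresentations1977, §2.4 Cor. 1 and §2.3 Ex. 2.6 (a)] -/
theorem dim_isotypical_one_regular_permAction_eq (hb : ∑ h, b.π h ≫ b.ι h = 𝟙 b.pt)
    (hρ : ∀ (g h : G), b.ι h ≫ End.asHom (ρ g) = b.ι (g • h)) (e : ratCharIdempotents G)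
    (he : (e : MonoidAlgebra ℚ G) = ratCharIdempotent (1 : G → ℂ)) : (image (u e)).dim = A.dim := by
  have h1 : Module.finrank ℂ (LinearMap.range ((Representation.ofMulAction ℂ G G).asAlgebraHom
      (MonoidAlgebra.mapRingHom G (algebraMap ℚ ℂ) (ratCharIdempotent (1 : G → ℂ))))) = 1 := by
    apply Nat.cast_injective (R := ℂ)
    rw [finrank_range_regular_ratCharIdempotent_eq isIrrChar_one,
      galoisClass_eq_singleton_of_forall_pow (χ := (1 : G → ℂ)) fun m _ ↦ rfl, Finset.card_singleton, Pi.one_apply]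
    norm_num
  rw [dim_isotypical_permAction_eq_finrank_mul b ρ hc hu hb hρ e, he, h1, one_mul]

/-! ## §2 Perfect field -/

section Isogeny

variable [PerfectField K]

/-- **`B_W(A^G) ∼ A^{[ℚ(χ):ℚ] · χ(1)²}`** for the regular power over a perfect field (`χ` irreducible of degree `d` in the class
`W`). [cite: SerreLinearRepresentations1977, §2.4 Cor. 1 and §2.6 Thm. 8 (ii)] [cite: LangeRodriguez2022, §2.9.1 Thm. 2.9.1 and Prop. 2.9.3 (PDF pp. 43, 46)]
[cite: LangeRecillas2004, §1 Prop. 1.1] -/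
theorem isIsogenous_isotypical_regular_permAction_biproduct (hb : ∑ h, b.π h ≫ b.ι h = 𝟙 b.pt)
    (hρ : ∀ (g h : G), b.ι h ≫ End.asHom (ρ g) = b.ι (g • h)) (e : ratCharIdempotents G) {χ : G → ℂ}
    (hχ : IsIrrChar G χ) (he : (e : MonoidAlgebra ℚ G) = ratCharIdempotent χ) {d : ℕ} (hd : χ 1 = d) :
    IsIsogenous (image (u e)) (⨁ fun _ : Fin (Module.finrank ℚ (charField χ) * d ^ 2) ↦ A) := by
  refine isIsogenous_iff_forall_finrank_hom_eq'.2 fun B ↦ ?_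
  rw [finrank_hom_isotypical_regular_permAction_eq b ρ hc hu B hb hρ e hχ he hd, finrank_hom_biproduct_const, Fintype.card_fin]

/-- **`B_1(A^G) ∼ A`**: the trivial component of the regular power is the diagonal up to isogeny (perfect field).
[cite: SerreLinearRepresentations1977, §2.4 Cor. 1 and §2.3 Ex. 2.6 (a)] [cite: LangeRodriguez2022, §3.5.2 (3.13) (PDF p. 69)] -/
theorem isIsogenous_isotypical_one_regular_permAction (hb : ∑ h, b.π h ≫ b.ι h = 𝟙 b.pt)
    (hρ : ∀ (g h : G), b.ι h ≫ End.asHom (ρ g) = b.ι (g • h)) (e : ratCharIdempotents G)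
    (he : (e : MonoidAlgebra ℚ G) = ratCharIdempotent (1 : G → ℂ)) : IsIsogenous (image (u e)) A := by
  refine isIsogenous_iff_forall_finrank_hom_eq'.2 fun B ↦ ?_
  have h1 : Module.finrank ℂ (LinearMap.range ((Representation.ofMulAction ℂ G G).asAlgebraHom
      (MonoidAlgebra.mapRingHom G (algebraMap ℚ ℂ) (ratCharIdempotent (1 : G → ℂ))))) = 1 := by
    apply Nat.cast_injective (R := ℂ)
    rw [finrank_range_regular_ratCharIdempotent_eq isIrrChar_one,
      galoisClass_eq_singleton_of_forall_pow (χ := (1 : G → ℂ)) fun m _ ↦ rfl, Finset.card_singleton, Pi.one_apply]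
    norm_num
  rw [finrank_hom_isotypical_permAction_eq_finrank_mul b ρ hc hu B hb hρ e, he, h1, one_mul]

end Isogeny

end AbelianVariety

end Literature.AlgebraicGeometry.Motives
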